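import Literature.MathematicalPhysics.QuantumFieldTheory.Balaban1983to89.B9Eq316PenaltyPointwiseBound

/-!
# `Balaban1983to89.B9Eq316PenaltyPointwiseBoundHeightFree` — T. Bałaban, *Propagators for lattice gauge theories in a background field*, Commun. Math.
# Phys. **99** (1985) 389–434 [Balaban1985BackgroundPropagators] (3.15)–(3.16) p. 393, (3.26) p. 395, (3.35)–(3.37) p. 396, Thm 3.3 p. 399, with
# [Balaban1985Averaging] (124)–(127) pp. 36–37: **THE TOWER `hQ` AND (P₂) LETTERS HEIGHT-FREE — under a geometric bond-window profile `ε_j ≤ ε_s·r^j`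
# (`0 ≤ r < 1`): `‖Q_k(U)f‖_{L²(c₁)} ≤ M_φ′M_φ√(c₁∕(c₀(L^k)^d))·exp(√(L^d)√(2d)·102(d+1)²L·ε_s∕(1−r))·‖f‖_{L²(c₀)}` and
# `‖((Q_k(U)†(a•Q_k(U)))v)(b)‖ ≤ |a|·C²∕√c₀·‖v‖` with THAT `C`, for EVERY number of levels `k = n+1`; on the diagonal `c₁ = c₀(L^k)^d` the `L²` constant is
# `M_φ′M_φ·exp(…)`, free of `k`** — the height-free reading of `B9Eq316PenaltyPointwiseBound` §4 through ne9-leaf-02's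
# `B9Eq315QTowerLipschitzL2.norm_QkW_sub_flat_le_L2_geometric`; the one-name suppliers the `H₁`-row tower census asks for («hQ ← consumer assembly … height-free
# under a summable `ε_j√(L^d)` regime — a letter, not a file», ne9-leaf-06 g81, journal l.62159)

statement-level skeleton of published theorems with citation tags; proofs where landed; nothing here is a claim about the Yang–Mills mass gap

CITATION HEADER (lean-in-tree rule).  Audit cell `pub-balaban`, sub-cell `t4`, BINDER row NE9; filed by NE9 formalisation-swarm LEAF PROVER 01
(`b2b-balaban-t4-ne9-formalise-leaf-01`, gen 87), INTENT I-ne9leaf01-g87-2, composing BY NAME `B9Eq315QTowerFlatNorm.norm_QkW_one_le` (ne9-leaf-03's flat tower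
count), `B9Eq315QTowerLipschitzL2.norm_QkW_sub_flat_le_L2_geometric` (ne9-leaf-02's `ℓ²`-telescoped `δ_{Q,k}` summed over a geometric profile) and this
lineage's §0 duality `B9Eq316PenaltyPointwiseBound.norm_adjoint_smul_apply_le_of_norm_le`.  Sources READ by this seat in the held text layer
`paper:balaban1985-cmp99-background-propagators` (journal page = PDF page + 388): p. 393 (3.15)–(3.16) (quoted in the parent's header); p. 396 (3.35)–(3.37),
the regularity class whose plaquette ∕ bond smallness DECREASES geometrically down the tower (the source of the profile `ε_j ≤ ε_s r^j` as the tree reads it,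
`B9Eq315QTowerLipschitzProfile`); p. 399 Thm 3.3.  NOTHING of print's random-walk proof is reproduced.

WHAT IS PROVED (sorry-free; proof lane — no `def`; [folklore] triangle + `exp` bookkeeping BY NAME; nothing of [B9] asserted).
* **`norm_QkW_le_of_geometric_window`** — the tower `hQ` with the height-free constant above (`flat·1 + flat·(exp − 1) = flat·exp`).
* **`norm_QkW_le_of_geometric_window_diagonal`** — on `c₁ = c₀(L^{n+1})^d`: `‖Q_k(U)f‖ ≤ M_φ′M_φ·exp(√(L^d)√(2d)·102(d+1)²L·ε_s∕(1−r))·‖f‖`, NO `k`.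
* **`norm_penalty_QkW_apply_le_of_geometric_window`** — (P₂) for the tower with `p₂ = |a|·C²∕√c₀`, the binder `hP₂` of the owner's
  `B9Eq326LocalPartSupBound.norm_localInv_apply_le` at `Pd := towerP L m (n+1)`, `Q := QkW …`.
MODEL ∕ DECLARED READINGS.  As the parent's §4: tower lattices `towerP L m (n+1)` over `TSite d m`, fibre along `φ`, weights `c₀`, `c₁`, the background through
`QkW`'s displayed per-level letters and the per-level bond windows `ε_j`; the profile `(ε_s, r)` is DISPLAYED (print's (3.35)–(3.37) make it geometric with
`r = L^{−1}`-type ratios — the consumer's reading, not asserted).  Duality's one-bond weight `1∕√c₀ = η^{−d∕2}` on the diagonal stays displayed honestly (it meets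
(I0)'s one-block mass `√μ`).
HONEST SCOPE.  Two displayed letters of the cell's substitute route re-read height-free; NOT Thm 3.1 ∕ 3.3; NOT NE9 (cell pub-balaban: NE9 NOT PRINTED ∕ NOT
PROVED; «NE9 ⇐ the named binders»; row WALLED ON A MODEL (O-NE9-1; #5 UNRULED); spine PROVED 0∕9; rung (B)+1 on a finite T⁴ — NOT infinite volume, NOT mass
gap, NOT BetaPertH, NOT Clay; HONEST DEPENDENCY: continuum YM on T⁴ ⇐ BetaPertH ∧ nine spine estimates (0/9 proved); BetaPertH ⇐ (D1) ∧ (D4) ∧ CAP+tail;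
G-an2-4 gates asym, D1 and NE2/3/4).  NEW file importing `B9Eq316PenaltyPointwiseBound` only; nothing modified.  Net new unproved facts: 0.
-/

noncomputable section

open scoped InnerProductSpace ComplexConjugate BigOperators

namespace Literature.MathematicalPhysics.QuantumFieldTheory.Balaban1983to89.B9Eq316PenaltyPointwiseBoundHeightFree

open B4Sect5Torus (TSite)
open B9SectCLatticeCarrier (Bond)
open B7Prop1Explicit (U1 Wcx boxVec)
open B9Eq311L2Pairing (WL2)
open B11Eq103H1Complex (BondL2K)
open B9Eq315QTorus (perCfg cornerSite)
open B9Eq315QTower (towerP UlevOf)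
open B9Eq315QTowerFlat (perCfg_UlevOf_one_mem_U1 norm_Wcx_UlevOf_one_sub_one_le)
open B9Eq326OperatorTower (QkW)
open B9Eq315QTowerLipschitzL2 (norm_QkW_sub_flat_le_L2_geometric)
open B9Eq315QTowerFlatNorm (norm_QkW_one_le)
open B9Eq316PenaltyPointwiseBound (norm_adjoint_smul_apply_le_of_norm_le)

variable {d : ℕ} {𝔸 : Type*} [NormedRing 𝔸] [NormedAlgebra ℂ 𝔸] [CompleteSpace 𝔸] [NormOneClass 𝔸]
  (L : ℕ) [NeZero L] (m : Fin d → ℕ) [∀ i, NeZero (m i)] (n : ℕ) (hL : 1 ≤ L)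
  {W : Type*} [NormedAddCommGroup W] [InnerProductSpace ℂ W] (φ : W ≃ₗ[ℂ] 𝔸) {Mφ Mφ' : ℝ} (hMφ : 0 ≤ Mφ) (hMφ' : 0 ≤ Mφ')
  (hφ : ∀ w, ‖φ w‖ ≤ Mφ * ‖w‖) (hφ' : ∀ X, ‖φ.symm X‖ ≤ Mφ' * ‖X‖) {c₀ c₁ : ℝ} [Fact (0 < c₀)] [Fact (0 < c₁)]
  (U : Bond d (towerP L m (n + 1)) → 𝔸ˣ) (α : ℕ → ℝ) (hα1 : ∀ j, α j ≤ 1 / 64)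
  (hU1 : ∀ (j : ℕ) (x : B7Prop1Explicit.Site d) (κ : Fin d), perCfg (towerP L m (j + 1)) (UlevOf L m (n + 1) U j) x κ ∈ U1 𝔸)
  (hreg : ∀ (j : ℕ) (y : TSite d (towerP L m j)) (κ : Fin d) (r : Fin d → Fin L),
    ‖((Wcx L (perCfg (towerP L m (j + 1)) (UlevOf L m (n + 1) U j)) (cornerSite L y) κ (boxVec L r) : 𝔸ˣ) : 𝔸) - 1‖ ≤ α j)
  (εU : ℕ → ℝ) (hεU : ∀ j, 0 ≤ εU j)
  (hUε : ∀ (j : ℕ) (b : Bond d (towerP L m (j + 1))), ‖(UlevOf L m (n + 1) U j b : 𝔸) - 1‖ ≤ εU j)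
  {r εs : ℝ} (hr0 : 0 ≤ r) (hr1 : r < 1) (hεs : 0 ≤ εs) (hεg : ∀ j < n + 1, εU j ≤ εs * r ^ j)

include hφ hφ' hMφ hMφ' hεU hUε hr0 hr1 hεs hεg in
/-- **THE TOWER `hQ`, HEIGHT-FREE ON A GEOMETRIC BOND-WINDOW PROFILE**: `ε_j ≤ ε_s r^j` (`0 ≤ r < 1`) ⟹
`‖Q_k(U)f‖_{L²(c₁)} ≤ M_φ′M_φ√(c₁∕(c₀(L^k)^d))·exp(√(L^d)√(2d)·102(d+1)²L·ε_s∕(1−r))·‖f‖_{L²(c₀)}`, `k = n+1` — the flat tower count plus the geometric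
`δ_{Q,k}` letter by the triangle inequality. [cite: Balaban1985BackgroundPropagators, (3.15)–(3.16) p.393, (3.35)–(3.37) p.396, p.407; Balaban1985Averaging, (125)–(127) pp.36–37] -/
theorem norm_QkW_le_of_geometric_window (f : BondL2K ℂ d (towerP L m (n + 1)) c₀ W) :
    ‖QkW L m n φ U hL α hα1 hU1 hreg (c₀ := c₀) (c₁ := c₁) f‖ ≤
      Mφ' * Mφ * Real.sqrt (c₁ / (c₀ * ((L : ℝ) ^ (n + 1)) ^ d)) *
        Real.exp (Real.sqrt ((L : ℝ) ^ d) * (Real.sqrt (2 * d) * (102 * (d + 1) ^ 2 * L)) * (εs / (1 - r))) * ‖f‖ := by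
  have h1 := norm_QkW_one_le L m n hL φ hMφ hφ hMφ' hφ' (c₀ := c₀) (c₁ := c₁) (fun _ => 0) (fun _ => by norm_num)
    (perCfg_UlevOf_one_mem_U1 L m (n + 1)) (norm_Wcx_UlevOf_one_sub_one_le L m (n + 1) (fun _ => 0) (fun _ => le_rfl)) f
  have h2 := norm_QkW_sub_flat_le_L2_geometric L m n hL φ hMφ hMφ' hφ hφ' U α hα1 hU1 hreg εU hεU hUε hr0 hr1 hεs hεg (c₀ := c₀) (c₁ := c₁) f
  have h3 := norm_add_le (QkW L m n φ U hL α hα1 hU1 hreg (c₀ := c₀) (c₁ := c₁) f -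
      QkW L m n φ (fun _ : Bond d (towerP L m (n + 1)) => (1 : 𝔸ˣ)) hL (fun _ => 0) (fun _ => by norm_num)
        (perCfg_UlevOf_one_mem_U1 L m (n + 1)) (norm_Wcx_UlevOf_one_sub_one_le L m (n + 1) (fun _ => 0) (fun _ => le_rfl)) (c₀ := c₀) (c₁ := c₁) f)
    (QkW L m n φ (fun _ : Bond d (towerP L m (n + 1)) => (1 : 𝔸ˣ)) hL (fun _ => 0) (fun _ => by norm_num)
        (perCfg_UlevOf_one_mem_U1 L m (n + 1)) (norm_Wcx_UlevOf_one_sub_one_le L m (n + 1) (fun _ => 0) (fun _ => le_rfl)) (c₀ := c₀) (c₁ := c₁) f)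
  rw [sub_add_cancel] at h3
  nlinarith [norm_nonneg f]

include hφ hφ' hMφ hMφ' hεU hUε hr0 hr1 hεs hεg in
/-- **… ON THE DIAGONAL `c₁ = c₀(L^{n+1})^d`: `‖Q_k(U)f‖ ≤ M_φ′M_φ·exp(√(L^d)√(2d)·102(d+1)²L·ε_s∕(1−r))·‖f‖` — NO `k` ANYWHERE** (the weight ratio is `1`).
[cite: Balaban1985BackgroundPropagators, (3.15)–(3.16) p.393, (3.35)–(3.37) p.396] -/
theorem norm_QkW_le_of_geometric_window_diagonal (hc : c₁ = c₀ * ((L : ℝ) ^ (n + 1)) ^ d) (f : BondL2K ℂ d (towerP L m (n + 1)) c₀ W) :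
    ‖QkW L m n φ U hL α hα1 hU1 hreg (c₀ := c₀) (c₁ := c₁) f‖ ≤
      Mφ' * Mφ * Real.exp (Real.sqrt ((L : ℝ) ^ d) * (Real.sqrt (2 * d) * (102 * (d + 1) ^ 2 * L)) * (εs / (1 - r))) * ‖f‖ := by
  have hc₀ : 0 < c₀ := Fact.out
  have hLk : (0 : ℝ) < ((L : ℝ) ^ (n + 1)) ^ d := by positivity
  have h := norm_QkW_le_of_geometric_window L m n hL φ hMφ hMφ' hφ hφ' U α hα1 hU1 hreg εU hεU hUε hr0 hr1 hεs hεg (c₀ := c₀) (c₁ := c₁) f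
  have h1 : Real.sqrt (c₁ / (c₀ * ((L : ℝ) ^ (n + 1)) ^ d)) = 1 := by
    rw [hc, div_self (by positivity), Real.sqrt_one]
  rwa [h1, mul_one] at h

variable [FiniteDimensional ℂ W]

include hφ hφ' hMφ hMφ' hεU hUε hr0 hr1 hεs hεg in
/-- **(P₂) FOR THE TOWER, HEIGHT-FREE ON A GEOMETRIC PROFILE**: `‖((Q_k(U)†(a•Q_k(U)))v)(b)‖ ≤ |a|·C²∕√c₀·‖v‖_{L²(c₀)}` with
`C = M_φ′M_φ√(c₁∕(c₀(L^k)^d))·exp(√(L^d)√(2d)·102(d+1)²L·ε_s∕(1−r))` — the binder `hP₂` of the owner's `B9Eq326LocalPartSupBound.norm_localInv_apply_le` at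
`Pd := towerP L m (n+1)`, `Q := QkW …`, by §0 duality of the parent at the height-free `hQ`.
[cite: Balaban1985BackgroundPropagators, (3.16) p.393, (3.26) p.395, (3.35)–(3.37) p.396, Thm 3.3 p.399; Balaban1985Averaging, (125)–(127) pp.36–37] -/
theorem norm_penalty_QkW_apply_le_of_geometric_window (a : ℝ) (v : BondL2K ℂ d (towerP L m (n + 1)) c₀ W) (b : Bond d (towerP L m (n + 1))) :
    ‖WL2.equiv ℂ (fun _ : Bond d (towerP L m (n + 1)) => c₀) W
        ((LinearMap.adjoint (QkW L m n φ U hL α hα1 hU1 hreg (c₀ := c₀) (c₁ := c₁)) ∘ₗ ((a : ℂ) • QkW L m n φ U hL α hα1 hU1 hreg (c₀ := c₀) (c₁ := c₁))) v) b‖ ≤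
      |a| * (Mφ' * Mφ * Real.sqrt (c₁ / (c₀ * ((L : ℝ) ^ (n + 1)) ^ d)) *
          Real.exp (Real.sqrt ((L : ℝ) ^ d) * (Real.sqrt (2 * d) * (102 * (d + 1) ^ 2 * L)) * (εs / (1 - r)))) ^ 2 / Real.sqrt c₀ * ‖v‖ := by
  have hK : 0 ≤ Mφ' * Mφ * Real.sqrt (c₁ / (c₀ * ((L : ℝ) ^ (n + 1)) ^ d)) *
      Real.exp (Real.sqrt ((L : ℝ) ^ d) * (Real.sqrt (2 * d) * (102 * (d + 1) ^ 2 * L)) * (εs / (1 - r))) := by positivity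
  calc ‖WL2.equiv ℂ (fun _ : Bond d (towerP L m (n + 1)) => c₀) W
        ((LinearMap.adjoint (QkW L m n φ U hL α hα1 hU1 hreg (c₀ := c₀) (c₁ := c₁)) ∘ₗ ((a : ℂ) • QkW L m n φ U hL α hα1 hU1 hreg (c₀ := c₀) (c₁ := c₁))) v) b‖
      ≤ ‖(a : ℂ)‖ * (Mφ' * Mφ * Real.sqrt (c₁ / (c₀ * ((L : ℝ) ^ (n + 1)) ^ d)) *
          Real.exp (Real.sqrt ((L : ℝ) ^ d) * (Real.sqrt (2 * d) * (102 * (d + 1) ^ 2 * L)) * (εs / (1 - r)))) ^ 2 / Real.sqrt c₀ * ‖v‖ :=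
        norm_adjoint_smul_apply_le_of_norm_le (w := fun _ : Bond d (towerP L m (n + 1)) => c₀) _ hK
          (norm_QkW_le_of_geometric_window L m n hL φ hMφ hMφ' hφ hφ' U α hα1 hU1 hreg εU hεU hUε hr0 hr1 hεs hεg (c₀ := c₀) (c₁ := c₁)) (a : ℂ) v b
    _ = _ := by rw [Complex.norm_real, Real.norm_eq_abs]

end Literature.MathematicalPhysics.QuantumFieldTheory.Balaban1983to89.B9Eq316PenaltyPointwiseBoundHeightFree

end
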